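import Literature.MathematicalPhysics.QuantumFieldTheory.Balaban1983to89.Node00.Record12Measurability

/-!
# NODE 00 — K0′ COMPONENTS G3, FILE 2: row P1 `intPiece` FOR AN ARBITRARY SELECTOR `Z ↦ Z″` — the R-step of record preserves
# integrability of the PIECES by the fibre mechanism of (0.4) [IV], with no positivity proviso on the denominators and no bound on the pieces

Cell `pub-ymgap`, NODE 00, prover seat `pub-ymgap-node00-def-K0c` (g0).  [III] = [Balaban1988Convergent], [IV] = [Balaban1989LargeFieldI].
Sequel of `Node00/Record12Measurability` (FILE 1), whose `Stage9Params.intPiece_of_localBg` needs the IDENTITY selector (`θ.ppSel = ppSelIdOfRecord …`,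
the selector of the carriers of record so far; there the R-step multiplies a slot by `F∕F ∈ {0,1}`).  def-R types the selector as RESIDUAL DATA with NO
canonical choice (`LargeFieldTowerOfRecord.PpSelOfRecord`: «the faithful object is the (1.100) datum»), so a later record may carry another selector; this
file removes the hypothesis.

WHAT THIS FILE IS.
* §1 THE FIBRE INEQUALITY (generic product of measure spaces; b01's `B15.BasicStep.lmarginal_ratio_term` WITHOUT its provisos `∫⌈den ≠ 0, ∞`): for measurable
  `den` and any `num`, `∫⌈_s [den · ofReal(toReal ∫⌈_s num ∕ toReal ∫⌈_s den)] ≤ ∫⌈_s num` fibrewise (`lmarginal_realRatio_term_le`) — the real ratio is a function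
  of the complementary variables and is `0` where the denominator vanishes or is infinite, so the normalised term integrates to `∫⌈ num` or to `0`.
* §2 ONE NORMALISED TERM `new · ∫⌈_{Z′}old ∕ ∫⌈_{Z′}new` of (0.3) (`B15.BasicStep.normTerm`) IS INTEGRABLE WHEN `old` IS (`integrable_normTerm_of_integrable`:
  measurable `new, old ≥ 0`; NO uniform bound, NO positivity of the denominators — b01's `integrable_normTerm` asks both), by Mathlib's
  `lintegral_le_of_lmarginal_le`.
* §3 OF RECORD: the R-step of record at ANY selector maps a slot family with integrable pieces `χ_k(s)·slot(s)` to one with integrable pieces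
  (`integrable_piece_rstepSlot` — the new piece is `Σ_{s : s″ = s′}` of normalised terms) and measurable slots (`measurable_rstepSlot`); by induction on the
  level with FILE 1's `integrable_tstepOfRecord` every piece of the represented tower of record is integrable (`piece_slotsOfRecord_measurable_integrable`),
  and **`Stage9Params.intPiece_of_localBg_anySel`**: `Provisos₁₀.intPiece` VERBATIM at EVERY `θ : Stage9Params` — no hypothesis on `θ.ppSel` — under
  (H-U) `LocalBgMeasurable F N θ.ν` ∧ (H-ζ) `ZetaMeasurable θ.ζ` ∧ the ζ-size law `IsZetaAbsLeOne` ∧ the SIGN LAW `0 ≤ ζ` (the fibre mechanism needs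
  non-negative pieces: n23-b's `slotsTOfRecord_nonneg` ∕ `wOfRecord_nonneg`).  Still NO bound on the marginal density of the averaging transport.

HONEST FRAMING — what this is NOT.  Kernel plumbing (Mathlib's `lmarginal` API, b01's `IndepOf` ∕ `lmarginal_mul_of_indepOf`, FILE 1, n23-b's sign lemmas, BY
NAME); (H-U), (H-ζ) remain DISPLAYED HYPOTHESES; nothing of Bałaban's is asserted; no field of `Provisos₁₂` is inhabited at `N ≥ 2`; K0′ is NOT discharged; no
node count moves (typed 28∕28 · discharged 5∕28).  One finite four-torus programme at fixed `ε = L^{−K}` — NOT the continuum limit on ℝ⁴, NOT infinite volume,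
NOT OS, NOT a mass gap, NOT the Clay problem.
-/

noncomputable section

open MeasureTheory
open scoped BigOperators NNReal ENNReal

namespace Literature.MathematicalPhysics.QuantumFieldTheory.Balaban1983to89.Node00

open T4Continuum B14.Eq218Concrete T4AveragingDisintegration T4FiniteEpsInhabited

/-! ## §1. The fibre inequality of one normalised term (generic) -/

section FibreInequality

open B15.BasicStep (IndepOf indepOf_lmarginal lmarginal_mul_of_indepOf)

variable {ι : Type*} {X : ι → Type*} [∀ i, MeasurableSpace (X i)] (μ : ∀ i, Measure (X i))

/-- In `ℝ≥0∞`: `ofReal(a.toReal ∕ b.toReal) · b ≤ a` (equality when `0 < b < ∞`, `a < ∞`; `0` when `b ∈ {0, ∞}`). [folklore] -/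
private theorem ofReal_toReal_div_toReal_mul_le (a b : ℝ≥0∞) : ENNReal.ofReal (a.toReal / b.toReal) * b ≤ a := by
  by_cases hb0 : b = 0
  · simp [hb0]
  by_cases hbt : b = ∞
  · simp [hbt]
  by_cases hat : a = ∞
  · exact hat ▸ le_top
  rw [ENNReal.ofReal_div_of_pos (ENNReal.toReal_pos hb0 hbt), ENNReal.ofReal_toReal hat, ENNReal.ofReal_toReal hbt,
    ENNReal.div_mul_cancel hb0 hbt]

/-- **THE FIBRE INEQUALITY OF ONE NORMALISED TERM** (b01's `lmarginal_ratio_term` WITHOUT the provisos `∫⌈den ≠ 0, ∞`): for measurable `den` and any `num`,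
`∫⌈_s [den · ofReal(toReal ∫⌈_s num ∕ toReal ∫⌈_s den)] ≤ ∫⌈_s num` fibrewise (the real ratio is a function of the complementary variables, and is `0` where the
denominator vanishes or is infinite). [cite: Balaban1989LargeFieldI, (0.3)–(0.4) p.176 (bookkeeping)] -/
theorem lmarginal_realRatio_term_le {instD : DecidableEq ι} (s : Finset ι) {num den : (∀ i, X i) → ℝ≥0∞} (hden : Measurable den) :
    ∫⋯∫⁻_s, (fun V => den V * ENNReal.ofReal (((∫⋯∫⁻_s, num ∂μ) V).toReal / ((∫⋯∫⁻_s, den ∂μ) V).toReal)) ∂μ ≤ ∫⋯∫⁻_s, num ∂μ := by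
  have hratio : IndepOf s (fun V => ENNReal.ofReal (((∫⋯∫⁻_s, num ∂μ) V).toReal / ((∫⋯∫⁻_s, den ∂μ) V).toReal)) := by
    intro x y
    simp only [indepOf_lmarginal μ s num x y, indepOf_lmarginal μ s den x y]
  have hrw : (fun V => den V * ENNReal.ofReal (((∫⋯∫⁻_s, num ∂μ) V).toReal / ((∫⋯∫⁻_s, den ∂μ) V).toReal))
      = (fun V => ENNReal.ofReal (((∫⋯∫⁻_s, num ∂μ) V).toReal / ((∫⋯∫⁻_s, den ∂μ) V).toReal)) * den := by
    ext V; simp [mul_comm]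
  rw [hrw, lmarginal_mul_of_indepOf s hratio hden]
  intro x
  simp only [Pi.mul_apply]
  exact ofReal_toReal_div_toReal_mul_le _ _

end FibreInequality

/-! ## §2. One normalised term of (0.3) is integrable when the old piece is -/

section NormTerm

open B15.BasicStep (fibreIntegral normTerm ofReal_comp_measurable fieldMeasure_eq_pi)

variable {P : Params} {j : ℕ} {G : Type*} [GaugeGroup G] [MeasurableSpace G] [HaarData G]

/-- A restricted integral `∫dV⌈_{s} h` of a measurable density is measurable (n23-b's private one-liner, any decidability instance). [folklore] -/
private theorem measurable_fibreIntegral'' {inst : DecidableEq (PBond P j)} (s : Finset (PBond P j)) {h : Density P j G} (hm : Measurable h) :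
    Measurable (@fibreIntegral P j G _ _ _ inst s h) :=
  ((ofReal_comp_measurable hm).lmarginal (fun _ : PBond P j => (HaarData.haar : Measure G))).ennreal_toReal

/-- **ONE NORMALISED TERM OF (0.3) IS INTEGRABLE WHEN THE OLD PIECE IS** — measurable `new, old ≥ 0`, `old` integrable; NO uniform bound on the pieces, NO
positivity of the denominators (b01's `integrable_normTerm` asks both). [cite: Balaban1989LargeFieldI, (0.3)–(0.4) p.176, (1.102) p.201 (bookkeeping)] -/
theorem integrable_normTerm_of_integrable {inst : DecidableEq (PBond P j)} (s : Finset (PBond P j)) {new old : Density P j G}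
    (hnew_m : Measurable new) (hold_m : Measurable old) (hnew0 : ∀ V, 0 ≤ new V) (hold0 : ∀ V, 0 ≤ old V)
    (hold_i : Integrable old (fieldMeasure P j G)) : Integrable (@normTerm P j G _ _ _ inst s new old) (fieldMeasure P j G) := by
  have hnt_m : Measurable (normTerm s new old) :=
    hnew_m.mul ((measurable_fibreIntegral'' s hold_m).div (measurable_fibreIntegral'' s hnew_m))
  have hnt0 : ∀ V, 0 ≤ normTerm s new old V := fun V => mul_nonneg (hnew0 V) (div_nonneg ENNReal.toReal_nonneg ENNReal.toReal_nonneg)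
  have hpt : ∀ V, ENNReal.ofReal (normTerm s new old V) = ENNReal.ofReal (new V) *
      ENNReal.ofReal (((∫⋯∫⁻_s, (fun U => ENNReal.ofReal (old U)) ∂(fun _ : PBond P j => (HaarData.haar : Measure G))) V).toReal /
        ((∫⋯∫⁻_s, (fun U => ENNReal.ofReal (new U)) ∂(fun _ : PBond P j => (HaarData.haar : Measure G))) V).toReal) := by
    intro V
    simp only [normTerm, fibreIntegral]
    rw [ENNReal.ofReal_mul (hnew0 V)]
  refine ⟨hnt_m.aestronglyMeasurable, ?_⟩
  rw [hasFiniteIntegral_iff_ofReal (Filter.Eventually.of_forall hnt0)]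
  calc ∫⁻ V, ENNReal.ofReal (normTerm s new old V) ∂(fieldMeasure P j G) ≤ ∫⁻ V, ENNReal.ofReal (old V) ∂(fieldMeasure P j G) := by
        rw [fieldMeasure_eq_pi]
        simp_rw [hpt]
        exact lintegral_le_of_lmarginal_le s
          ((ofReal_comp_measurable hnew_m).mul (ENNReal.measurable_ofReal.comp
            ((measurable_fibreIntegral'' s hold_m).div (measurable_fibreIntegral'' s hnew_m))))
          (ofReal_comp_measurable hold_m) (lmarginal_realRatio_term_le _ s (ofReal_comp_measurable hnew_m))
    _ < ∞ := (hasFiniteIntegral_iff_ofReal (Filter.Eventually.of_forall hold0)).1 hold_i.hasFiniteIntegral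

end NormTerm

/-! ## §3. Of record: the R-step at any selector, the tower induction, row P1 for every Stage-9 parameter -/

section GeneralSelectorOfRecord

variable (F : T4Family) (N : ℕ) [NeZero N]

open B15.BasicStep (fibreIntegral normTerm)

variable (ν : Stage7Numerics) (τ : TowerNumerics) {p : B12.RunParams} {g : ℕ → ℝ} {k : ℕ}

/-- **THE R-STEP OF RECORD PRESERVES INTEGRABILITY OF THE PIECES, ANY SELECTOR**: the new piece `χ_k(s′)·(R-slot)(s′) = Σ_{s : s″ = s′} t_{s′}·∫⌈_{Z′(s)}t_s ∕ ∫⌈_{Z′(s)}t_{s′}`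
(`t = χ_k · slot ≥ 0`) is a finite sum of normalised terms, each integrable by `integrable_normTerm_of_integrable`. [cite: Balaban1989LargeFieldI, (0.3)–(0.4) p.176 (bookkeeping)] -/
theorem integrable_piece_rstepSlot (sel : SeqOfRecord F ν τ.M g p.K k → SeqOfRecord F ν τ.M g p.K k) {f : TexpASlot F N ν τ.M p g k}
    (hf : ∀ s, Measurable (f s)) (hf0 : ∀ s V, 0 ≤ f s V) (hχ : ∀ s, Measurable (chiSeqOfRecord F N ν τ.M g p.K k s))
    (hi : ∀ s, Integrable (fun V => chiSeqOfRecord F N ν τ.M g p.K k s V * f s V) (fieldMeasure (F.P p.K) k (SU N)))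
    (s' : SeqOfRecord F ν τ.M g p.K k) :
    Integrable (fun V => chiSeqOfRecord F N ν τ.M g p.K k s' V * rstepSlot F N ν τ p g k sel f s' V) (fieldMeasure (F.P p.K) k (SU N)) := by
  have ht0 : ∀ s V, 0 ≤ chiSeqOfRecord F N ν τ.M g p.K k s V * f s V := fun s V =>
    mul_nonneg (chiSeqOfRecord_nonneg F N ν τ.M g p.K k s V) (hf0 s V)
  unfold rstepSlot rstepOfSel
  dsimp only
  simp_rw [← mul_assoc, Finset.mul_sum]
  refine integrable_finsetSum _ fun a _ => ?_
  exact integrable_normTerm_of_integrable (fibOfSeq F ν τ p g k a) ((hχ s').mul (hf s')) ((hχ a).mul (hf a)) (ht0 s') (ht0 a) (hi a)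

/-- The R-stepped slot is measurable, any selector (measurable slot and χ's; the ratios are quotients of restricted integrals).
[cite: Balaban1989LargeFieldI, (0.3) p.176 (bookkeeping)] -/
theorem measurable_rstepSlot (sel : SeqOfRecord F ν τ.M g p.K k → SeqOfRecord F ν τ.M g p.K k) {f : TexpASlot F N ν τ.M p g k}
    (hf : ∀ s, Measurable (f s)) (hχ : ∀ s, Measurable (chiSeqOfRecord F N ν τ.M g p.K k s)) (s' : SeqOfRecord F ν τ.M g p.K k) :
    Measurable (rstepSlot F N ν τ p g k sel f s') := by
  have hm : ∀ b, Measurable (rterm (sliceOfRecord F N ν τ.M p g k f) b) := fun b => (hχ b).mul (hf b)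
  unfold rstepSlot rstepOfSel
  dsimp only
  refine (hf s').mul (Finset.measurable_sum _ fun a _ => ?_)
  unfold rratio
  exact (measurable_fibreIntegral'' _ (hm a)).div (measurable_fibreIntegral'' _ (hm s'))

/-- **EVERY PIECE OF THE REPRESENTED TOWER OF RECORD IS INTEGRABLE, ANY SELECTOR**, levels `k ≤ K`, GIVEN measurable χ's, jointly measurable step weights with
`|w| ≤ 1` AND `0 ≤ w` (induction: the T-step by `integrable_tstepOfRecord`, the R-step by `integrable_piece_rstepSlot`; signs by n23-b's `slotsTOfRecord_nonneg`).
[cite: Balaban1988Convergent, (2.18) p.257, (3.24)–(3.25) p.270; Balaban1989LargeFieldI, (0.3)–(0.4) p.176 (bookkeeping)] -/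
theorem piece_slotsOfRecord_measurable_integrable (E : B12.RunParams → ℝ) {w : StepWeightsOfRecord F N ν τ.M} (ppSel : PpSelOfRecord F ν τ.M)
    (hw : ∀ k, k < p.K → ∀ s', Measurable (fun z : GaugeField (F.P p.K) (k + 1) (SU N) × GaugeField (F.P p.K) k (SU N) => w p g k s' z.2 z.1))
    (hwb : ∀ k, k < p.K → ∀ s' U V', |w p g k s' U V'| ≤ 1) (hw0 : ∀ p g k s' U V', 0 ≤ w p g k s' U V')
    (hχ : ∀ k, k ≤ p.K → ∀ s, Measurable (chiSeqOfRecord F N ν τ.M g p.K k s)) :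
    ∀ k, k ≤ p.K → (∀ s, Measurable (slotsOfRecord F N ν τ E w ppSel p g k s)) ∧
      ∀ s, Integrable (fun U => chiSeqOfRecord F N ν τ.M g p.K k s U * slotsOfRecord F N ν τ E w ppSel p g k s U) (fieldMeasure (F.P p.K) k (SU N)) := by
  intro k; induction k with
  | zero =>
    intro _
    have hm : ∀ s : SeqOfRecord F ν τ.M g p.K 0, Measurable (slotsOfRecord F N ν τ E w ppSel p g 0 s) := fun s => by
      show Measurable (rhoZeroOfRecord F N p.K (g 0) (E p))
      exact (Missing.measurable_boltzmann RegularGaugeGroup.measurable_reTr (F.P p.K) _).const_mul _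
    refine ⟨hm, fun s => (integrable_const (Real.exp (-E p))).mono' ((hχ 0 (Nat.zero_le _) s).mul (hm s)).aestronglyMeasurable
      (ae_of_all _ fun V => ?_)⟩
    rw [Real.norm_eq_abs, chiSeqOfRecord_zero, one_mul]
    show |Real.exp (-E p) * Missing.boltzmann (F.P p.K) ((g 0)⁻¹ ^ 2) V| ≤ Real.exp (-E p)
    rw [abs_of_nonneg (mul_nonneg (Real.exp_pos _).le (Missing.boltzmann_pos (F.P p.K) _ V).le)]
    exact mul_le_of_le_one_right (Real.exp_pos _).le (Missing.boltzmann_le_one (F.P p.K) (sq_nonneg _) V)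
  | succ k ih =>
    intro hk
    have hk' : k < p.K := Nat.lt_of_succ_le hk
    obtain ⟨hm, hpiece⟩ := ih hk'.le
    have hTm : ∀ s', Measurable (slotsTOfRecord F N ν τ E w ppSel p g (k + 1) s') := fun s' => by
      rw [slotsTOfRecord_succ]; exact measurable_tstepOfRecord F N ν τ.M (hw k hk') hm (hχ k hk'.le) s'
    have hTi : ∀ s', Integrable (slotsTOfRecord F N ν τ E w ppSel p g (k + 1) s') (fieldMeasure (F.P p.K) (k + 1) (SU N)) :=
      fun s' => by rw [slotsTOfRecord_succ]; exact integrable_tstepOfRecord F N ν τ.M hk' (hw k hk') (hwb k hk') hpiece s'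
    have hT0 := slotsTOfRecord_nonneg F N ν τ E hw0 ppSel p g (k + 1)
    have hTpiece : ∀ s', Integrable (fun V => chiSeqOfRecord F N ν τ.M g p.K (k + 1) s' V * slotsTOfRecord F N ν τ E w ppSel p g (k + 1) s' V)
        (fieldMeasure (F.P p.K) (k + 1) (SU N)) := fun s' =>
      (hTi s').bdd_mul (hχ (k + 1) hk s').aestronglyMeasurable
        (ae_of_all _ fun U => by rw [Real.norm_eq_abs]; exact abs_chiSeqOfRecord_le_one F N ν τ.M g p.K (k + 1) s' U)
    refine ⟨fun s => ?_, fun s => ?_⟩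
    · rw [slotsOfRecord_succ]; exact measurable_rstepSlot F N ν τ (ppSel p g (k + 1)) hTm (hχ (k + 1) hk) s
    · rw [slotsOfRecord_succ]
      exact integrable_piece_rstepSlot F N ν τ (ppSel p g (k + 1)) hTm hT0 (hχ (k + 1) hk) hTpiece s

variable {F N} in
/-- **ROW P1 `intPiece` FOR ANY SELECTOR** under (H-U) ∧ (H-ζ) ∧ the ζ-size law ∧ `0 ≤ ζ`: `Provisos₁₀.intPiece` verbatim at EVERY `θ : Stage9Params`
(no hypothesis on `θ.ppSel`). [cite: Balaban1988Convergent, (2.18) p.257, (3.24)–(3.25) p.270; Balaban1989LargeFieldI, (0.3)–(0.4) p.176 (bookkeeping)] -/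
theorem Stage9Params.intPiece_of_localBg_anySel (θ : Stage9Params F N) (hU : LocalBgMeasurable F N θ.ν) (hζ : ZetaMeasurable F N θ.ζ)
    (hζa : IsZetaAbsLeOne F N θ.ν θ.τ9.M θ.ζ) (hζ0 : ∀ p g k s Pl Ql RS U V', 0 ≤ θ.ζ p g k s Pl Ql RS U V') :
    ∀ (p : B12.RunParams) (k : ℕ), k < p.K → ∀ s : SeqOfRecord F θ.ν θ.τ9.M (gOfRecord₁₀ F N θ p) p.K k,
      Integrable (fun U => chiSeqOfRecord F N θ.ν θ.τ9.M (gOfRecord₁₀ F N θ p) p.K k s U *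
        slotsOfRecord F N θ.ν θ.τ9 (EOfRecord₁₀ F N θ) (wOfRecord₉ F N θ) θ.ppSel p (gOfRecord₁₀ F N θ p) k s U) (fieldMeasure (F.P p.K) k (SU N)) :=
  fun p k hk s => (piece_slotsOfRecord_measurable_integrable F N θ.ν θ.τ9 (EOfRecord₁₀ F N θ) θ.ppSel
    (fun j _ s' => measurable_wOfRecord_of_localBg hU θ.τ9.M θ.A₁ hζ p _ j s')
    (fun j _ s' U V' => abs_wOfRecord_le_one F N θ.ν θ.τ9.M θ.A₁ hζa p _ j s' U V')
    (fun p' g' j s' U V' => wOfRecord_nonneg F N θ.ν θ.τ9.M p' g' j θ.A₁ hζ0 s' U V')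
    (fun j _ s' => measurable_chiSeqOfRecord_of_localBg hU θ.τ9.M _ p.K j s') k hk.le).2 s

end GeneralSelectorOfRecord

end Literature.MathematicalPhysics.QuantumFieldTheory.Balaban1983to89.Node00

end
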